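/-
Copyright (c) 2026. All rights reserved.
Released under Apache 2.0 license as described in the file LICENSE.
Authors: abc-iut cell, seat abc-iut-L4-t8 (gen 9; L4-lead row «TYPE-CHOL-THPLUS», file 4: the `TB⊞`-leg of
[AbsTopIII] Def 5.6 (iv) as a FUNCTOR `𝒞^hol_{TH⊞} ⥤ TB⊞`, over file 3 `ArchimedeanHolGroupPairsTBPlus`).
-/
import Literature.AnabelianGeometry.AbsoluteAnabelian.ArchimedeanHolGroupPairsTBPlus
import HarnessLib

/-!
# [AbsTopIII] Def 5.6 (iv): the `TB⊞`-leg `𝒞^hol_{TH⊞} ⥤ TB⊞` on MORPHISMS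

S. Mochizuki, *Topics in absolute anabelian geometry III*, kurims manuscript (`paper:url-5493eb38cbb7`;
`MochizukiAbsTopIII2015`), Def 5.6 (iv) p.136 (the `TB⊞`-component of «we obtain, in a natural way, an
object of `𝒞^{hol⊢}_{TB⊞}`» and the functor `𝒞^hol_{TH⊞} → 𝒞^{hol⊢}_{TB⊞}` of the [1-]commutative diagram),
Def 5.6 (i) p.134 (morphisms of `TB⊞`: «the surjective homomorphisms `B₁ → B₂` of topological groups that
are compatible with the `B′_i, B″_i, β_i`»).

A morphism `(φ_𝕏, φ_M) : (𝕏₁ ↶ M₁) → (𝕏₂ ↶ M₂)` of `𝒞^hol_{TH⊞}` is sent to the surjective homomorphism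
`φ_M : M₁ → M₂`; its compatibility with the pulled-back one-parameter subgroups `B′ = κ⁻¹(S¹)`,
`B″ = κ⁻¹(ℝ_{>0})` follows from the Kummer compatibility `κ₂ ∘ φ_M = 𝒜_{φ_𝕏} ∘ κ₁` and the UNIQUENESS of
one-parameter subgroups with given image under the Kummer homomorphism (`hom_eq_of_κ_eq`: a continuous
homomorphism `ℝ → M` is determined by `κ ∘ −`, because the kernel of `κ` is discrete); the rescalings are
`a₁ = ±1` — the sign of the continuous field automorphism `τ = e₂ ∘ c₂⁻¹ ∘ 𝒜_{φ_𝕏} ∘ c₁ ∘ e₁⁻¹` of `ℂ`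
(`id` or complex conjugation, Mathlib `Complex.ringHom_eq_id_or_conj_of_continuous`), which flips `S¹` and
fixes `ℝ_{>0}` — and `a₂ = 1`:

* `THPlusShape.eq_of_kummer_eq` / `HolTHPlusPair.hom_eq_of_κ_eq` — uniqueness of lifts of one-parameter
  subgroups along the Kummer homomorphism;
* `HolTHPlusPair.Hom.τ`, `Hom.sign` (`= ±1`), `τ_I`, `τ_ofReal`, `exp_τ`, `c_chart_symm_τ`;
* ★ `HolTHPlusPair.toTBPlusMap`, ★ `HolTHPlusPair.toTBPlus : HolTHPlusPair 𝔄 ⥤ TBPlus` (Def 5.6 (iv)),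
  with `toTBPlus_obj`, `toTBPlus_map_toHom` (`rfl`: the underlying homomorphism IS `φ_M`).

Refereed pre-IUT material; a MODEL (kernel definitions); no instances, no notation; nothing here bears on
[IUTchIII] Cor. 3.12; typed ≠ proved.
-/

set_option autoImplicit false

noncomputable section

namespace Literature.AnabelianGeometry.AbsoluteAnabelian

open _root_.CategoryTheory _root_.Topology _root_.Complex

universe u

/-! ### §1 Uniqueness of one-parameter subgroups with prescribed Kummer image -/

namespace THPlusShape

variable {k : Type u} [NormedField k]

/-- An additive continuous map `d : ℝ → ℂ` with `exp ∘ d = 1` vanishes (the kernel `2πiℤ` of `exp` is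
discrete: `d` vanishes near `0`, hence everywhere by `d(n·x) = n·d(x)`). [cite: MochizukiAbsTopIII2015, Definition 4.1 (i) p.101] -/
theorem eq_zero_of_exp_eq_one (d : ℝ →+ ℂ) (hd : Continuous d) (h : ∀ t, exp (d t) = 1) (t : ℝ) : d t = 0 := by
  -- near `0`, `‖d s‖ < 2π` forces `d s = 0`
  have h0 : d 0 = 0 := map_zero d
  have hsmall : ∀ s : ℝ, ‖d s‖ < 2 * Real.pi → d s = 0 := by
    intro s hs
    obtain ⟨n, hn⟩ := exp_eq_one_iff.mp (h s)
    have h2pi : ‖(2 * (Real.pi : ℂ) * I)‖ = 2 * Real.pi := by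
      rw [norm_mul, norm_I, mul_one, show (2 : ℂ) * (Real.pi : ℂ) = ((2 * Real.pi : ℝ) : ℂ) by push_cast; ring,
        norm_real, Real.norm_of_nonneg (by positivity)]
    have hnorm : ‖d s‖ = |(n : ℝ)| * (2 * Real.pi) := by rw [hn, norm_mul, norm_intCast, h2pi]
    have hn0 : n = 0 := by
      by_contra hne
      have h1 : (1 : ℝ) ≤ |(n : ℝ)| := by exact_mod_cast Int.one_le_abs hne
      have : 2 * Real.pi ≤ ‖d s‖ := by rw [hnorm]; nlinarith [Real.pi_pos]
      linarith
    rw [hn, hn0, Int.cast_zero, zero_mul]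
  obtain ⟨δ, hδ, hδlt⟩ : ∃ δ > 0, ∀ s : ℝ, |s| < δ → ‖d s‖ < 2 * Real.pi := by
    have hc : ContinuousAt d 0 := hd.continuousAt
    have := Metric.continuousAt_iff.mp hc (2 * Real.pi) (by positivity)
    obtain ⟨δ, hδ, hball⟩ := this
    refine ⟨δ, hδ, fun s hs => ?_⟩
    have := hball (show dist s 0 < δ by simpa using hs)
    simpa [h0, dist_eq_norm] using this
  -- scale down
  obtain ⟨n, hn⟩ := exists_nat_gt (|t| / δ)
  have hnpos : 0 < (n : ℝ) := lt_of_le_of_lt (by positivity) hn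
  have hn0 : (n : ℝ) ≠ 0 := hnpos.ne'
  have hsmall' : |t / n| < δ := by
    rw [abs_div, abs_of_pos hnpos, div_lt_iff₀ hnpos]
    calc |t| = (|t| / δ) * δ := by field_simp
      _ < n * δ := mul_lt_mul_of_pos_right hn hδ
      _ = δ * n := mul_comm _ _
  have hkey : d t = n • d (t / n) := by
    rw [← map_nsmul, nsmul_eq_mul]
    congr 1
    field_simp
  rw [hkey, hsmall _ (hδlt _ hsmall'), smul_zero]

/-- **Uniqueness of lifts of one-parameter subgroups along the Kummer homomorphism** (shape level): two
continuous homomorphisms `ℝ →` (the shape's group in `k`) with the same image under the Kummer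
homomorphism coincide — for `k^×` because `κ = c` is injective, for `k∼` because `exp ∘ e ∘ (p₁ - p₂)`
is `1` with `p₁ - p₂` additive and continuous. [cite: MochizukiAbsTopIII2015, Definition 5.6 (iv) p.136] -/
theorem eq_of_kummer_eq [CharZero k] {A : Type u} [NormedField A] (s : THPlusShape) (c : k ≃+* A)
    (e : k ≃+* ℂ) (he : Continuous e) (he' : Continuous e.symm) {p₁ p₂ : ℝ → k}
    (hp₁ : Continuous p₁) (hp₂ : Continuous p₂)
    (hadd₁ : ∀ a b, p₁ (a + b) = s.op (p₁ a) (p₁ b)) (hadd₂ : ∀ a b, p₂ (a + b) = s.op (p₂ a) (p₂ b))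
    (hκ : ∀ t, s.kummer c (p₁ t) = s.kummer c (p₂ t)) : p₁ = p₂ := by
  cases s
  · funext t
    exact c.injective (hκ t)
  · -- `d := e ∘ p₁ - e ∘ p₂` is additive, continuous, with `exp ∘ d = 1`
    have hadd : ∀ a b, (e (p₁ (a + b)) - e (p₂ (a + b))) =
        (e (p₁ a) - e (p₂ a)) + (e (p₁ b) - e (p₂ b)) := by
      intro a b
      rw [hadd₁, hadd₂]
      change e (p₁ a + p₁ b) - e (p₂ a + p₂ b) = _
      rw [map_add, map_add]
      ring
    let d : ℝ →+ ℂ :=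
      { toFun := fun t => e (p₁ t) - e (p₂ t)
        map_zero' := by
          have h1 : p₁ 0 = 0 := by
            have := hadd₁ 0 0
            rw [add_zero] at this
            change p₁ 0 = p₁ 0 + p₁ 0 at this
            have h := this.symm
            rwa [add_eq_left] at h
          have h2 : p₂ 0 = 0 := by
            have := hadd₂ 0 0
            rw [add_zero] at this
            change p₂ 0 = p₂ 0 + p₂ 0 at this
            have h := this.symm
            rwa [add_eq_left] at h
          rw [h1, h2, sub_self]
        map_add' := hadd }
    have hdc : Continuous d := (he.comp hp₁).sub (he.comp hp₂)
    have hexp : ∀ t, exp (d t) = 1 := by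
      intro t
      have h := hκ t
      change c (univCover k (p₁ t)) = c (univCover k (p₂ t)) at h
      have h' := c.injective h
      rw [IsCAF.univCover_eq e he', IsCAF.univCover_eq e he'] at h'
      have h'' := e.symm.injective h'
      change exp (e (p₁ t) - e (p₂ t)) = 1
      rw [exp_sub, h'', div_self (exp_ne_zero _)]
    funext t
    have := eq_zero_of_exp_eq_one d hdc hexp t
    change e (p₁ t) - e (p₂ t) = 0 at this
    exact e.injective (sub_eq_zero.mp this)

end THPlusShape

namespace HolTHPlusPair

variable {𝔄 : AutHolFieldFunctor.{u}}

/-- **A continuous homomorphism `ℝ → M` is determined by its composite with the Kummer homomorphism**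
`κ : M → 𝒜_𝕏^×` (uniqueness of lifts of one-parameter subgroups).
[cite: MochizukiAbsTopIII2015, Definition 5.6 (iv) p.136] -/
theorem hom_eq_of_κ_eq (Q : HolTHPlusPair 𝔄) (γ₁ γ₂ : ℝ →ₜ+ Q.B)
    (h : ∀ t, Q.κ (γ₁ t) = Q.κ (γ₂ t)) : γ₁ = γ₂ := by
  have hp : (fun t => (Q.pres (γ₁ t) : Q.k)) = fun t => (Q.pres (γ₂ t) : Q.k) := by
    refine @THPlusShape.eq_of_kummer_eq Q.k _ Q.charZero_k _ _ Q.shape Q.c Q.chart Q.continuous_chart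
      Q.continuous_chart_symm _ _ ?_ ?_ ?_ ?_ ?_
    · exact continuous_subtype_val.comp (Q.pres.continuous.comp γ₁.continuous)
    · exact continuous_subtype_val.comp (Q.pres.continuous.comp γ₂.continuous)
    · intro a b; rw [map_add, Q.pres_add]
    · intro a b; rw [map_add, Q.pres_add]
    · intro t; exact (Q.κ_def _).symm.trans ((h t).trans (Q.κ_def _))
  apply ContinuousAddMonoidHom.ext
  intro t
  apply Q.pres.injective
  exact Subtype.ext (congrFun hp t)

/-! ### §2 The sign of a morphism -/

namespace Hom

variable {P Q R : HolTHPlusPair 𝔄}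

/-- The continuous field automorphism of `ℂ` induced by a morphism through the charts and the Kummer
charts: `τ = e₂ ∘ c₂⁻¹ ∘ 𝒜_{φ_𝕏} ∘ c₁ ∘ e₁⁻¹`. [cite: MochizukiAbsTopIII2015, Definition 5.6 (iv) p.136] -/
def τ (φ : P ⟶ Q) : ℂ ≃+* ℂ :=
  P.chart.symm.trans (P.c.trans ((𝔄.Amap φ.base).trans (Q.c.symm.trans Q.chart)))

/-- `τ` evaluated. [cite: MochizukiAbsTopIII2015, Definition 5.6 (iv) p.136] -/
theorem τ_apply (φ : P ⟶ Q) (z : ℂ) :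
    τ φ z = Q.chart (Q.c.symm (𝔄.Amap φ.base (P.c (P.chart.symm z)))) := rfl

/-- **`τ` IS abc-iut-w6-d025's transition automorphism `e_𝕐 ∘ 𝒜_{φ_𝕏} ∘ e_𝕏⁻¹`** of
`AutHolFieldFunctorMonoAnalyticization` (the Kummer charts cancel).
[cite: MochizukiAbsTopIII2015, Definition 5.6 (iv) p.136] -/
theorem τ_apply_eq_transition (φ : P ⟶ Q) (z : ℂ) : τ φ z = AutHolFieldFunctor.transition φ.base z := by
  rw [τ_apply, chart_symm_apply, chart_apply, RingEquiv.apply_symm_apply, RingEquiv.apply_symm_apply]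
  rfl

/-- `τ` is continuous. [cite: MochizukiAbsTopIII2015, Definition 5.6 (iv) p.136] -/
theorem continuous_τ (φ : P ⟶ Q) : Continuous (τ φ) :=
  Q.continuous_chart.comp (Q.continuous_c_symm.comp ((𝔄.continuous_Amap _).comp
    (P.continuous_c.comp P.continuous_chart_symm)))

/-- `τ` is the identity or complex conjugation. [cite: MochizukiAbsTopIII2015, Definition 5.6 (iv) p.136] -/
theorem τ_eq_id_or_conj (φ : P ⟶ Q) :
    (τ φ).toRingHom = RingHom.id ℂ ∨ (τ φ).toRingHom = starRingEnd ℂ :=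
  ringHom_eq_id_or_conj_of_continuous (continuous_τ φ)

/-- The `B′`-rescaling of a morphism: `+1` if `τ = id`, `-1` if `τ = conj` (read off as `Im τ(i)`).
[cite: MochizukiAbsTopIII2015, Definition 5.6 (iv) p.136] -/
def sign (φ : P ⟶ Q) : ℝ := (τ φ I).im

/-- `τ(i) = sign · i`. [cite: MochizukiAbsTopIII2015, Definition 5.6 (iv) p.136] -/
theorem τ_I (φ : P ⟶ Q) : τ φ I = (sign φ : ℂ) * I := by
  unfold sign
  rcases τ_eq_id_or_conj φ with h | h
  · have : τ φ I = I := by change (τ φ).toRingHom I = I; rw [h]; rfl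
    rw [this]; simp
  · have : τ φ I = -I := by change (τ φ).toRingHom I = -I; rw [h]; exact conj_I
    rw [this]; simp

/-- `τ` fixes the reals. [cite: MochizukiAbsTopIII2015, Definition 5.6 (iv) p.136] -/
theorem τ_ofReal (φ : P ⟶ Q) (t : ℝ) : τ φ t = t := by
  rcases τ_eq_id_or_conj φ with h | h
  · change (τ φ).toRingHom t = t; rw [h]; rfl
  · change (τ φ).toRingHom t = t; rw [h]; exact conj_ofReal t

/-- `|sign| = 1`. [cite: MochizukiAbsTopIII2015, Definition 5.6 (iv) p.136] -/
theorem abs_sign (φ : P ⟶ Q) : |sign φ| = 1 := by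
  unfold sign
  rcases τ_eq_id_or_conj φ with h | h
  · have : τ φ I = I := by change (τ φ).toRingHom I = I; rw [h]; rfl
    rw [this]; simp
  · have : τ φ I = -I := by change (τ φ).toRingHom I = -I; rw [h]; exact conj_I
    rw [this]; simp

/-- `τ` commutes with `exp`. [cite: MochizukiAbsTopIII2015, Definition 5.6 (iv) p.136] -/
theorem exp_τ (φ : P ⟶ Q) (z : ℂ) : exp (τ φ z) = τ φ (exp z) := by
  rcases τ_eq_id_or_conj φ with h | h
  · change exp ((τ φ).toRingHom z) = (τ φ).toRingHom (exp z); rw [h]; rfl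
  · change exp ((τ φ).toRingHom z) = (τ φ).toRingHom (exp z); rw [h]; exact exp_conj z

/-- `τ` on `i s` and on reals, combined: `τ(i s) = i (sign·s)`. [cite: MochizukiAbsTopIII2015, Definition 5.6 (iv) p.136] -/
theorem τ_I_mul (φ : P ⟶ Q) (s : ℝ) : τ φ (I * s) = I * ((sign φ * s : ℝ) : ℂ) := by
  rw [map_mul, τ_I, τ_ofReal, ofReal_mul]; ring

/-- The defining property of `τ` read back through the charts: `c₂ (e₂⁻¹ (τ z)) = 𝒜_{φ_𝕏} (c₁ (e₁⁻¹ z))`.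
[cite: MochizukiAbsTopIII2015, Definition 5.6 (iv) p.136] -/
theorem c_chart_symm_τ (φ : P ⟶ Q) (z : ℂ) :
    Q.c (Q.chart.symm (τ φ z)) = 𝔄.Amap φ.base (P.c (P.chart.symm z)) := by
  rw [τ_apply, RingEquiv.symm_apply_apply, RingEquiv.apply_symm_apply]

/-- `τ` of a composite is the composite. [cite: MochizukiAbsTopIII2015, Definition 5.6 (iv) p.136] -/
theorem τ_comp_apply (φ : P ⟶ Q) (ψ : Q ⟶ R) (z : ℂ) : τ (φ ≫ ψ) z = τ ψ (τ φ z) := by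
  rw [τ_apply, τ_apply, τ_apply, comp_base, 𝔄.Amap_comp_apply, RingEquiv.symm_apply_apply,
    RingEquiv.apply_symm_apply]

/-- `sign` of an identity is `1`. [cite: MochizukiAbsTopIII2015, Definition 5.6 (iv) p.136] -/
theorem sign_id (P : HolTHPlusPair 𝔄) : sign (𝟙 P) = 1 := by
  unfold sign
  rw [τ_apply, id_base, 𝔄.Amap_id_apply, RingEquiv.symm_apply_apply, RingEquiv.apply_symm_apply, I_im]

/-- `sign` is multiplicative. [cite: MochizukiAbsTopIII2015, Definition 5.6 (iv) p.136] -/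
theorem sign_comp (φ : P ⟶ Q) (ψ : Q ⟶ R) : sign (φ ≫ ψ) = sign ψ * sign φ := by
  have h : τ (φ ≫ ψ) I = ((sign ψ * sign φ : ℝ) : ℂ) * I := by
    rw [τ_comp_apply, τ_I, map_mul, τ_ofReal, τ_I, ofReal_mul]; ring
  unfold sign at h ⊢
  rw [h]
  simp

end Hom

/-! ### §3 The functor `𝒞^hol_{TH⊞} ⥤ TB⊞` -/

/-- The rescaling `t ↦ a t` of the real line as a continuous homomorphism. [cite: MochizukiAbsTopIII2015, Definition 5.6 (i) p.134] -/
def scaleHom (a : ℝ) : ℝ →ₜ+ ℝ := ⟨AddMonoidHom.mulLeft a, continuous_const.mul continuous_id⟩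

/-- ★ **The `TB⊞`-morphism of a morphism of `𝒞^hol_{TH⊞}`**: the surjective homomorphism `φ_M`, which
carries `B′₁ = κ₁⁻¹(S¹)` onto `B′₂` with rescaling `sign φ = ±1` and `B″₁ = κ₁⁻¹(ℝ_{>0})` onto `B″₂` with
rescaling `1` (by the Kummer compatibility and the uniqueness of lifts), compatibly with `β₁ = β₂ = 1`.
[cite: MochizukiAbsTopIII2015, Definition 5.6 (iv) p.136] -/
def toTBPlusMap {P Q : HolTHPlusPair 𝔄} (φ : P ⟶ Q) : P.toTBPlusObj ⟶ Q.toTBPlusObj where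
  toHom := φ.arith
  surjective := φ.surj
  a₁ := Hom.sign φ
  a₂ := 1
  map_c₁ s := by
    have h := hom_eq_of_κ_eq Q (φ.arith.comp (P.oneParam I)) ((Q.oneParam I).comp (scaleHom (Hom.sign φ)))
      (fun t => by
        change Q.κ (φ.arith (P.toTBPlusObj.c₁ t)) = Q.κ (Q.toTBPlusObj.c₁ (Hom.sign φ * t))
        rw [φ.compat, κ_c₁, κ_c₁, ← Hom.τ_I_mul, Hom.exp_τ, Hom.c_chart_symm_τ])
    exact DFunLike.congr_fun h s
  map_c₂ s := by
    have h := hom_eq_of_κ_eq Q (φ.arith.comp (P.oneParam 1)) ((Q.oneParam 1).comp (scaleHom 1))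
      (fun t => by
        change Q.κ (φ.arith (P.toTBPlusObj.c₂ t)) = Q.κ (Q.toTBPlusObj.c₂ (1 * t))
        rw [φ.compat, κ_c₂, κ_c₂, one_mul]
        conv_rhs => rw [← Hom.τ_ofReal φ t, Hom.exp_τ]
        rw [Hom.c_chart_symm_τ])
    exact DFunLike.congr_fun h s
  map_β := by
    change |(1 : ℝ)| * 1 = 1 * |Hom.sign φ|
    rw [Hom.abs_sign, abs_one]

variable (𝔄) in
/-- ★★ **Def 5.6 (iv): the `TB⊞`-leg `𝒞^hol_{TH⊞} ⥤ TB⊞`** — on objects the pulled-back `(B, B′, B″, β)`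
(`toTBPlusObj`), on morphisms `φ_M` with rescalings `(sign φ, 1)`.
[cite: MochizukiAbsTopIII2015, Definition 5.6 (iv) p.136] -/
def toTBPlus : HolTHPlusPair 𝔄 ⥤ TBPlus.{u} where
  obj P := P.toTBPlusObj
  map φ := toTBPlusMap φ
  map_id P := TBPlus.Hom.ext rfl (Hom.sign_id P) rfl
  map_comp φ ψ := TBPlus.Hom.ext rfl (Hom.sign_comp φ ψ) (by change (1 : ℝ) = 1 * 1; rw [mul_one])

/-- The `TB⊞`-leg on objects. [cite: MochizukiAbsTopIII2015, Definition 5.6 (iv) p.136] -/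
theorem toTBPlus_obj (P : HolTHPlusPair 𝔄) : (toTBPlus 𝔄).obj P = P.toTBPlusObj := rfl

/-- **The `TB⊞`-leg on morphisms is `φ_M` itself.** [cite: MochizukiAbsTopIII2015, Definition 5.6 (iv) p.136] -/
theorem toTBPlus_map_toHom {P Q : HolTHPlusPair 𝔄} (φ : P ⟶ Q) : ((toTBPlus 𝔄).map φ).toHom = φ.arith :=
  rfl

/-- The `B′`-rescaling is the sign `±1`. [cite: MochizukiAbsTopIII2015, Definition 5.6 (iv) p.136] -/
theorem toTBPlus_map_a₁ {P Q : HolTHPlusPair 𝔄} (φ : P ⟶ Q) : ((toTBPlus 𝔄).map φ).a₁ = Hom.sign φ := rfl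

/-- The `B″`-rescaling is `1`. [cite: MochizukiAbsTopIII2015, Definition 5.6 (iv) p.136] -/
theorem toTBPlus_map_a₂ {P Q : HolTHPlusPair 𝔄} (φ : P ⟶ Q) : ((toTBPlus 𝔄).map φ).a₂ = 1 := rfl

end HolTHPlusPair

end Literature.AnabelianGeometry.AbsoluteAnabelian

end
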